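/-
COR-CM (cell pub-hodgecm2, stage 2 of the Hodge ladder) — count-neutral KERNEL COMBINATORICS «the clock-type dictionary of the quartic twist»
(seat prover-pub-hodgecm2-b23-g41-0, binder prover b23, gen 41; claim QUARTIC-TRANSPORT F1, HOME/INBOX.md l.10098).
Bookkeeping definitions with bodies (`lab`, `typeOf`, `typeEquiv`, `pl`, `plInv`) + theorems; Mathlib-only mathematics on top of seat b09's
clock model `Census/QuarticTwistModel.lean` (I) / `Census/QuarticTwistSquares.lean` (II) and the intrinsic currency `CorCM/Prior/AllgGroup1.lean` /
`Census/BlockParityLaw.lean`, all used BY NAME; no `decide` beyond closed numeral facts in `ZMod 4` / `ZMod 2`, no certificate, no named fact,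
no `sorry`; `Interfaces.lean` (C1), every E term, B01, `Transposition/*`, `PortJoin/*` untouched.
HONEST FRAMING: `HC_CM` is NOT proved, here or anywhere in the tree; nothing here is a period, a count of record or a headline.
T5: n/a-class (no Prop-valued hypothesis binder beyond the datum equations `θ (P * Q) = θ P + θ Q`, `θ c = (2, 0)`); checker: self, 2026-08-23.
-/
import Summits.HodgeConjecture.CorCM.Census.QuarticTwistSquares
import Summits.HodgeConjecture.CorCM.Census.BlockParityLaw

/-!
# The clock-type dictionary of the quartic twist: abstract CM types of `(G, c)` ↔ clock maps `B → ℤ/4`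

Seat b09's law of the QUARTIC TWIST (`Census/QuarticTwist*`: for every finite group `B` with `|B| ≥ 3`,
`μ_hodge(ℤ/4 × B, (2,0)) = β − 1 − [∃ t ∈ B, 4 ∣ ord t]`) is stated in the CLOCK MODEL: labels `Ty B = B → ZMod 4`, Pohlmann forms `coef`,
the action `tw`, flips `flip`, face classes `faceVec`, the lattices `hodge B`, `pairs B`, `spanFaces B S`.  The census' currency of record is the
INTRINSIC one of `CorCM/Prior/AllgGroup1.lean` / `Census/BlockParityLaw.lean` / `Census/CoinvariantFibre.lean`: a finite group `G`, a central
involution `c`, the abstract CM types `CMF G c` (`Ψ ⊆ G`, `G = Ψ ⊔ cΨ`), base change `rt`, flips `oflipCM`, faces `gface`, pairs, `translates`,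
`hodgeSpan`, `Block`.  This file is the DICTIONARY between the two (seat b09's SPEC, `HOME/pub-hodgecm2-b09/lean-g32/QUARTIC-TWIST.md` § Transport),
for EVERY finite group `G` carrying a

**quartic datum**: a bijection `θ : G ≃ ZMod 4 × B` with `θ (P * Q) = θ P + θ Q` and `θ c = (2, 0)` (`B` any finite group, written additively
as in the clock model) — i.e. `G = ⟨u⟩ × B` with `u = θ⁻¹(1,0)` central of order `4` and `c = u²`.  For a Galois CM field `F = k₄·L` (`k₄` cyclic
quartic CM, `L` totally real Galois with group `B`, linearly disjoint) this is `G = GalT F`, `c = conjT` (file `CorCM/FaceQuarticTwistGeneration.lean`).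

* §1 consequences of the datum: `θ 1 = 0`, `θ P⁻¹ = −θ P`, `c * c = 1`, `c ≠ 1`, `c` central, `c·θ⁻¹(x,b) = θ⁻¹(x+2,b)`.
* §2 **labels** `lab θ Ψ : Ty B` — a CM type meets the column `θ⁻¹(ℤ/4 × {b})` in the ARC `{lab b, lab b + 1}` (`symm_mem_iff`); the inverse
  `typeOf` (membership = b09's `coef = +1` condition, `mem_typeOf`) and the bijection **`typeEquiv : CMF G c ≃ Ty B`**.
* §3 **conjugation is `+ 2`** (`lab_rt_self`: `lab (Ψ·c) = lab Ψ + 2`) and **base change is a twist**: `lab (rt Q Ψ) = tw (−(θQ).1, (θQ).2) (lab Ψ)`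
  (`lab_rt`; the sign records that `rt Q` translates a type by `−θQ` on the right while `tw (v,t)` translates its graph by `(v, −t)`), and
  conversely `typeOf (tw g s) = rt (θ⁻¹(−g.1, g.2)) (typeOf s)` (`typeOf_tw`).
* §4 **places and flips**: the place `{t, ct}` of `G` is the pair `pl θ t = (par (θt).1, (θt).2) ∈ ZMod 2 × B` (`mem_orb_iff_pl_eq`, `pl_plInv`),
  and the abstract flip is b09's flip: `lab (Ψ^{(t)}) = flip (pl t) (lab Ψ)` (`lab_oflipCM`, `oflipCM_typeOf`).

Part F2 (`Census/ClockTypesTransport.lean`) transports the lattices (`hodge ↔ hodgeSpan`, `pairs ↔ span pairSet`, `faceVec ↔ gface`,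
`transl ↔ mapDomain rt`), F3 the law, F4 the field form.

## References
* [Pohlmann1968] H. Pohlmann, Algebraic cycles on abelian varieties of complex multiplication type, Ann. of Math. 88 (1968), Thm 1.
* [Milne1999] J. S. Milne, Lefschetz motives and the Tate conjecture, Compositio Math. 117 (1999), Prop. 2.1, p. 54.
-/

namespace Summit.HodgeConjecture.CorCM.Census.ClockTypes

open Finset
open Summit.HodgeConjecture.CorCM.Prior.AllgGroup.RfwfAllgGroup
open Summit.HodgeConjecture.CorCM.Census.BlockParity
open Summit.HodgeConjecture.CorCM.Census.QuarticTwist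

noncomputable section

variable {G : Type*} [Group G] [Fintype G] [DecidableEq G] {c : G}
variable {B : Type} [AddGroup B] [Fintype B] [DecidableEq B]
variable (θ : G ≃ ZMod 4 × B)

/-! ## §1 The quartic datum and its first consequences -/

omit [Fintype G] [DecidableEq G] [Fintype B] [DecidableEq B] in
/-- A quartic datum sends `1` to `0`. [folklore] -/
theorem map_one_eq (hθ : ∀ P Q : G, θ (P * Q) = θ P + θ Q) : θ 1 = 0 := by
  have h : θ 1 + 0 = θ 1 + θ 1 := by rw [add_zero, ← hθ, one_mul]
  exact (add_left_cancel h).symm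

omit [Fintype G] [DecidableEq G] [Fintype B] [DecidableEq B] in
/-- A quartic datum sends inverses to negatives. [folklore] -/
theorem map_inv_eq (hθ : ∀ P Q : G, θ (P * Q) = θ P + θ Q) (P : G) : θ P⁻¹ = -θ P :=
  eq_neg_of_add_eq_zero_left (by rw [← hθ, inv_mul_cancel, map_one_eq θ hθ])

omit [Fintype G] [DecidableEq G] [Fintype B] [DecidableEq B] in
/-- The inverse datum is multiplicative: `θ⁻¹(g + h) = θ⁻¹ g · θ⁻¹ h`. [folklore] -/
theorem symm_add (hθ : ∀ P Q : G, θ (P * Q) = θ P + θ Q) (g h : ZMod 4 × B) : θ.symm (g + h) = θ.symm g * θ.symm h :=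
  θ.injective (by rw [hθ, Equiv.apply_symm_apply, Equiv.apply_symm_apply, Equiv.apply_symm_apply])

omit [Fintype G] [DecidableEq G] [Fintype B] [DecidableEq B] in
/-- **`c` is an involution**: `c * c = 1`. [folklore] -/
theorem c_mul_c (hθ : ∀ P Q : G, θ (P * Q) = θ P + θ Q) (hθc : θ c = (2, 0)) : c * c = 1 :=
  θ.injective (by
    rw [hθ, hθc, map_one_eq θ hθ, Prod.mk_add_mk, add_zero]
    refine Prod.ext ?_ rfl
    show (2 : ZMod 4) + 2 = 0
    decide)

omit [Fintype G] [DecidableEq G] [Fintype B] [DecidableEq B] in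
/-- **`c ≠ 1`.** [folklore] -/
theorem c_ne_one (hθ : ∀ P Q : G, θ (P * Q) = θ P + θ Q) (hθc : θ c = (2, 0)) : c ≠ 1 := by
  intro h
  have h2 : ((2 : ZMod 4), (0 : B)) = 0 := by rw [← hθc, h, map_one_eq θ hθ]
  have h2' : (2 : ZMod 4) = 0 := (Prod.ext_iff.mp h2).1
  exact absurd h2' (by decide)

omit [Fintype G] [DecidableEq G] [Fintype B] [DecidableEq B] in
/-- **`c` is central.** [folklore] -/
theorem mul_comm_of_datum (hθ : ∀ P Q : G, θ (P * Q) = θ P + θ Q) (hθc : θ c = (2, 0)) (x : G) : x * c = c * x :=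
  θ.injective (by
    rw [hθ, hθ, hθc]
    exact Prod.ext (by simp only [Prod.fst_add]; exact add_comm _ _) (by simp only [Prod.snd_add, add_zero, zero_add]))

omit [Fintype G] [DecidableEq G] [Fintype B] [DecidableEq B] in
/-- `c · θ⁻¹(x, b) = θ⁻¹(x + 2, b)`: multiplying by `c` moves two steps around the clock, in the same column. [folklore] -/
theorem c_mul_symm (hθ : ∀ P Q : G, θ (P * Q) = θ P + θ Q) (hθc : θ c = (2, 0)) (x : ZMod 4) (b : B) :
    c * θ.symm (x, b) = θ.symm (x + 2, b) :=
  θ.injective (by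
    rw [hθ, hθc, Equiv.apply_symm_apply, Equiv.apply_symm_apply, Prod.mk_add_mk, zero_add, add_comm])

omit [Fintype G] [DecidableEq G] [Fintype B] [DecidableEq B] in
/-- `θ⁻¹(x, b) · c = θ⁻¹(x + 2, b)`. [folklore] -/
theorem symm_mul_c (hθ : ∀ P Q : G, θ (P * Q) = θ P + θ Q) (hθc : θ c = (2, 0)) (x : ZMod 4) (b : B) :
    θ.symm (x, b) * c = θ.symm (x + 2, b) := by
  rw [mul_comm_of_datum θ hθ hθc, c_mul_symm θ hθ hθc]

/-! ## §2 Clock labels of abstract CM types -/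

/-- **The clock label** of an abstract CM type along the datum `θ`: `lab θ Ψ b` is the start of the arc `{x, x + 1} ⊆ ℤ/4` in which `Ψ` meets
the column `θ⁻¹(ℤ/4 × {b})` (a CM type contains exactly one of `θ⁻¹(0,b), θ⁻¹(2,b)` and exactly one of `θ⁻¹(1,b), θ⁻¹(3,b)`). [folklore] -/
def lab (Ψ : CMF G c) : Ty B := fun b =>
  if θ.symm (0, b) ∈ Ψ.1 then (if θ.symm (1, b) ∈ Ψ.1 then 0 else 3) else (if θ.symm (3, b) ∈ Ψ.1 then 2 else 1)

omit [Fintype B] [DecidableEq B] in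
/-- The CM-type property in a column: `θ⁻¹(x, b) ∈ Ψ ↔ θ⁻¹(x + 2, b) ∉ Ψ`. [folklore] -/
theorem symm_mem_iff_not_mem (hθ : ∀ P Q : G, θ (P * Q) = θ P + θ Q) (hθc : θ c = (2, 0)) (Ψ : CMF G c) (x : ZMod 4) (b : B) :
    θ.symm (x, b) ∈ Ψ.1 ↔ θ.symm (x + 2, b) ∉ Ψ.1 := by
  have h := Ψ.2 (θ.symm (x, b))
  rwa [c_mul_symm θ hθ hθc] at h

omit [Fintype B] [DecidableEq B] in
/-- **A CM type meets each column in the arc of its label**: `θ⁻¹(x, b) ∈ Ψ ↔ x ∈ {lab θ Ψ b, lab θ Ψ b + 1}`. [folklore] -/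
theorem symm_mem_iff (hθ : ∀ P Q : G, θ (P * Q) = θ P + θ Q) (hθc : θ c = (2, 0)) (Ψ : CMF G c) (x : ZMod 4) (b : B) :
    θ.symm (x, b) ∈ Ψ.1 ↔ x = lab θ Ψ b ∨ x = lab θ Ψ b + 1 := by
  have h0 := symm_mem_iff_not_mem θ hθ hθc Ψ 0 b
  have h1 := symm_mem_iff_not_mem θ hθ hθc Ψ 1 b
  rw [show (0 : ZMod 4) + 2 = 2 by decide] at h0
  rw [show (1 : ZMod 4) + 2 = 3 by decide] at h1
  have h2 : θ.symm (2, b) ∈ Ψ.1 ↔ θ.symm (0, b) ∉ Ψ.1 := by rw [h0, not_not]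
  have h3 : θ.symm (3, b) ∈ Ψ.1 ↔ θ.symm (1, b) ∉ Ψ.1 := by rw [h1, not_not]
  have hx : x = 0 ∨ x = 1 ∨ x = 2 ∨ x = 3 := by revert x; decide
  simp only [lab]
  by_cases a : θ.symm (0, b) ∈ Ψ.1 <;> by_cases d : θ.symm (1, b) ∈ Ψ.1 <;>
    simp only [a, d, ↓reduceIte] <;> rcases hx with rfl | rfl | rfl | rfl <;>
    simp only [a, d, h2, h3, not_true_eq_false, not_false_eq_true, true_iff, false_iff] <;> decide

omit [Fintype B] [DecidableEq B] in
/-- Membership of a group element in a CM type, read on the clock: `P ∈ Ψ ↔ (θP).1 ∈ {lab θ Ψ (θP).2, lab θ Ψ (θP).2 + 1}`. [folklore] -/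
theorem mem_iff_lab (hθ : ∀ P Q : G, θ (P * Q) = θ P + θ Q) (hθc : θ c = (2, 0)) (Ψ : CMF G c) (P : G) :
    P ∈ Ψ.1 ↔ (θ P).1 = lab θ Ψ (θ P).2 ∨ (θ P).1 = lab θ Ψ (θ P).2 + 1 := by
  have h := symm_mem_iff θ hθ hθc Ψ (θ P).1 (θ P).2
  rwa [Prod.mk.eta, Equiv.symm_apply_apply] at h

/-- Arcs determine their start. [folklore] -/
private theorem arc_unique : ∀ y y' : ZMod 4, (∀ x : ZMod 4, (x = y ∨ x = y + 1) ↔ (x = y' ∨ x = y' + 1)) → y = y' := by decide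

/-- The CM-type axiom for arcs: `x ∈ {y, y+1} ↔ 2 + x ∉ {y, y+1}`. [folklore] -/
private theorem arc_compl : ∀ x y : ZMod 4, (x = y ∨ x = y + 1) ↔ ¬ (2 + x = y ∨ 2 + x = y + 1) := by decide

/-- **The abstract CM type of a clock label** `s : B → ℤ/4`: `{P | (θP).1 ∈ {s (θP).2, s (θP).2 + 1}}` (membership = seat b09's condition
`coef (θ P) s = +1`). [folklore] -/
def typeOf (hθ : ∀ P Q : G, θ (P * Q) = θ P + θ Q) (hθc : θ c = (2, 0)) (s : Ty B) : CMF G c :=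
  ⟨univ.filter fun P => (θ P).1 = s (θ P).2 ∨ (θ P).1 = s (θ P).2 + 1, fun P => by
    simp only [mem_filter, mem_univ, true_and, hθ, hθc, Prod.fst_add, Prod.snd_add, zero_add]
    exact arc_compl (θ P).1 (s (θ P).2)⟩

omit [Fintype B] [DecidableEq B] in
/-- Membership in the type of a label. [folklore] -/
theorem mem_typeOf (hθ : ∀ P Q : G, θ (P * Q) = θ P + θ Q) (hθc : θ c = (2, 0)) (s : Ty B) (P : G) :
    P ∈ (typeOf θ hθ hθc s).1 ↔ (θ P).1 = s (θ P).2 ∨ (θ P).1 = s (θ P).2 + 1 := by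
  simp [typeOf]

omit [Fintype B] [DecidableEq B] in
/-- Membership in the type of a label, clock coordinates: `θ⁻¹(x, b) ∈ typeOf s ↔ x ∈ {s b, s b + 1}`. [folklore] -/
theorem symm_mem_typeOf (hθ : ∀ P Q : G, θ (P * Q) = θ P + θ Q) (hθc : θ c = (2, 0)) (s : Ty B) (x : ZMod 4) (b : B) :
    θ.symm (x, b) ∈ (typeOf θ hθ hθc s).1 ↔ x = s b ∨ x = s b + 1 := by
  rw [mem_typeOf, Equiv.apply_symm_apply]

omit [Fintype B] [DecidableEq B] in
/-- `lab ∘ typeOf = id`. [folklore] -/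
theorem lab_typeOf (hθ : ∀ P Q : G, θ (P * Q) = θ P + θ Q) (hθc : θ c = (2, 0)) (s : Ty B) : lab θ (typeOf θ hθ hθc s) = s :=
  funext fun b => arc_unique _ _ fun x => by rw [← symm_mem_iff θ hθ hθc, symm_mem_typeOf]

omit [Fintype B] [DecidableEq B] in
/-- `typeOf ∘ lab = id`. [folklore] -/
theorem typeOf_lab (hθ : ∀ P Q : G, θ (P * Q) = θ P + θ Q) (hθc : θ c = (2, 0)) (Ψ : CMF G c) : typeOf θ hθ hθc (lab θ Ψ) = Ψ := by
  apply Subtype.ext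
  ext P
  obtain ⟨⟨x, b⟩, rfl⟩ := θ.symm.surjective P
  rw [symm_mem_typeOf, symm_mem_iff θ hθ hθc]

/-- **THE DICTIONARY**: abstract CM types of `(G, c)` ≃ clock labels `B → ℤ/4`. [folklore] -/
def typeEquiv (hθ : ∀ P Q : G, θ (P * Q) = θ P + θ Q) (hθc : θ c = (2, 0)) : CMF G c ≃ Ty B where
  toFun := lab θ
  invFun := typeOf θ hθ hθc
  left_inv := typeOf_lab θ hθ hθc
  right_inv := lab_typeOf θ hθ hθc

omit [Fintype B] [DecidableEq B] in
/-- `typeEquiv Ψ = lab Ψ`. [folklore] -/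
@[simp] theorem typeEquiv_apply (hθ : ∀ P Q : G, θ (P * Q) = θ P + θ Q) (hθc : θ c = (2, 0)) (Ψ : CMF G c) :
    typeEquiv θ hθ hθc Ψ = lab θ Ψ := rfl

omit [Fintype B] [DecidableEq B] in
/-- `typeEquiv⁻¹ s = typeOf s`. [folklore] -/
@[simp] theorem typeEquiv_symm_apply (hθ : ∀ P Q : G, θ (P * Q) = θ P + θ Q) (hθc : θ c = (2, 0)) (s : Ty B) :
    (typeEquiv θ hθ hθc).symm s = typeOf θ hθ hθc s := rfl

omit [Fintype B] [DecidableEq B] in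
/-- `lab` is injective. [folklore] -/
theorem lab_injective (hθ : ∀ P Q : G, θ (P * Q) = θ P + θ Q) (hθc : θ c = (2, 0)) : Function.Injective (lab (c := c) θ) :=
  (typeEquiv θ hθ hθc).injective

omit [Fintype B] [DecidableEq B] in
/-- `typeOf` is injective. [folklore] -/
theorem typeOf_injective (hθ : ∀ P Q : G, θ (P * Q) = θ P + θ Q) (hθc : θ c = (2, 0)) : Function.Injective (typeOf θ hθ hθc) :=
  (typeEquiv θ hθ hθc).symm.injective

/-! ## §3 Conjugation and base change on the clock -/

/-- Clock arithmetic: shifting an arc by `2`. [folklore] -/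
private theorem arc_add_two : ∀ x y : ZMod 4, (x + 2 = y ∨ x + 2 = y + 1) ↔ (x = y + 2 ∨ x = y + 2 + 1) := by decide

/-- Clock arithmetic: shifting an arc by `v`. [folklore] -/
private theorem arc_add : ∀ x v y : ZMod 4, (x + v = y ∨ x + v = y + 1) ↔ (x = y + -v ∨ x = y + -v + 1) := by decide

omit [Fintype B] [DecidableEq B] in
/-- **Conjugation is `+ 2` on the clock**: `lab (Ψ·c) = lab Ψ + 2` (for central `c`, `Ψ·c = Ψ̄`, `BlockParity.rt_self_val`). [folklore] -/
theorem lab_rt_self (hθ : ∀ P Q : G, θ (P * Q) = θ P + θ Q) (hθc : θ c = (2, 0)) (Ψ : CMF G c) : lab θ (rt c c Ψ) = lab θ Ψ + 2 := by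
  funext b
  refine arc_unique _ _ fun x => ?_
  rw [← symm_mem_iff θ hθ hθc, mem_rt, symm_mul_c θ hθ hθc, symm_mem_iff θ hθ hθc, Pi.add_apply, Pi.ofNat_apply, arc_add_two]

omit [Fintype B] [DecidableEq B] in
/-- **Base change is a twist**: `lab (rt Q Ψ) = tw (−(θQ).1, (θQ).2) (lab Ψ)` — the type `Ψ·Q⁻¹` read on the clock is b09's twist of the label
by `(−v, t)`, `θ Q = (v, t)`. [folklore] -/
theorem lab_rt (hθ : ∀ P Q : G, θ (P * Q) = θ P + θ Q) (hθc : θ c = (2, 0)) (Q : G) (Ψ : CMF G c) :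
    lab θ (rt c Q Ψ) = tw B (-(θ Q).1, (θ Q).2) (lab θ Ψ) := by
  funext b
  refine arc_unique _ _ fun x => ?_
  have hmul : θ.symm (x, b) * Q = θ.symm (x + (θ Q).1, b + (θ Q).2) := by
    rw [← Prod.mk_add_mk, Prod.mk.eta, symm_add θ hθ, Equiv.symm_apply_apply]
  rw [← symm_mem_iff θ hθ hθc, mem_rt, hmul, symm_mem_iff θ hθ hθc, arc_add]
  simp only [tw]

omit [Fintype B] [DecidableEq B] in
/-- Base change on types of labels: `rt Q (typeOf s) = typeOf (tw (−(θQ).1, (θQ).2) s)`. [folklore] -/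
theorem rt_typeOf (hθ : ∀ P Q : G, θ (P * Q) = θ P + θ Q) (hθc : θ c = (2, 0)) (Q : G) (s : Ty B) :
    rt c Q (typeOf θ hθ hθc s) = typeOf θ hθ hθc (tw B (-(θ Q).1, (θ Q).2) s) := by
  apply lab_injective θ hθ hθc
  rw [lab_rt θ hθ hθc, lab_typeOf, lab_typeOf]

omit [Fintype B] [DecidableEq B] in
/-- **Twists are base changes**: `typeOf (tw g s) = rt (θ⁻¹(−g.1, g.2)) (typeOf s)`. [folklore] -/
theorem typeOf_tw (hθ : ∀ P Q : G, θ (P * Q) = θ P + θ Q) (hθc : θ c = (2, 0)) (g : ZMod 4 × B) (s : Ty B) :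
    typeOf θ hθ hθc (tw B g s) = rt c (θ.symm (-g.1, g.2)) (typeOf θ hθ hθc s) := by
  rw [rt_typeOf θ hθ hθc, Equiv.apply_symm_apply]
  simp only [neg_neg, Prod.mk.eta]

omit [Fintype B] [DecidableEq B] in
/-- Conjugate types of labels: `rt c (typeOf s) = typeOf (s + 2)`. [folklore] -/
theorem rt_self_typeOf (hθ : ∀ P Q : G, θ (P * Q) = θ P + θ Q) (hθc : θ c = (2, 0)) (s : Ty B) :
    rt c c (typeOf θ hθ hθc s) = typeOf θ hθ hθc (s + 2) := by
  apply lab_injective θ hθ hθc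
  rw [lab_rt_self θ hθ hθc, lab_typeOf, lab_typeOf]

omit [Fintype B] [DecidableEq B] in
/-- Twisting a label twice by `(2, 0)`-type data: `typeOf (s + 2 + 2) = typeOf s`. [folklore] -/
theorem typeOf_add_two_add_two (hθ : ∀ P Q : G, θ (P * Q) = θ P + θ Q) (hθc : θ c = (2, 0)) (s : Ty B) :
    typeOf θ hθ hθc (s + 2 + 2) = typeOf θ hθ hθc s := by
  congr 1
  funext b
  simp only [Pi.add_apply, Pi.ofNat_apply, add_assoc]
  rw [show (2 : ZMod 4) + 2 = 0 by decide, add_zero]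

/-! ## §4 Places and flips -/

/-- **The place of `t`** on the clock: `pl θ t = (par (θt).1, (θt).2)` — the pair `{t, ct}` is `θ⁻¹({x, x+2} × {b})`. [folklore] -/
def pl (t : G) : ZMod 2 × B := (QuarticTwist.par (θ t).1, (θ t).2)

/-- A group element at a given place: `plInv θ (j, b) = θ⁻¹(j, b)` (`j ∈ {0,1}` lifted to `ℤ/4`). [folklore] -/
def plInv (p : ZMod 2 × B) : G := θ.symm (if p.1 = 0 then 0 else 1, p.2)

/-- Parities on the clock: same parity iff equal or opposite. [folklore] -/
private theorem par_eq_par_iff : ∀ a a' : ZMod 4, QuarticTwist.par a' = QuarticTwist.par a ↔ (a' = a ∨ a' = 2 + a) := by decide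

/-- The lift `{0,1} → ℤ/4` has the right parity. [folklore] -/
private theorem par_lift : ∀ j : ZMod 2, QuarticTwist.par (if j = 0 then (0 : ZMod 4) else 1) = j := by decide

omit [Group G] [Fintype G] [DecidableEq G] [AddGroup B] [Fintype B] [DecidableEq B] in
/-- `pl (plInv p) = p`: every clock place is the place of a group element. [folklore] -/
@[simp] theorem pl_plInv (p : ZMod 2 × B) : pl θ (plInv θ p) = p := by
  unfold pl plInv
  rw [Equiv.apply_symm_apply]
  exact Prod.ext (par_lift p.1) rfl

omit [Group G] [Fintype G] [DecidableEq G] [AddGroup B] [Fintype B] [DecidableEq B] in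
/-- `pl` is surjective. [folklore] -/
theorem pl_surjective : Function.Surjective (pl θ) := fun p => ⟨plInv θ p, pl_plInv θ p⟩

omit [Fintype G] [DecidableEq G] [Fintype B] [DecidableEq B] in
/-- The place of `c·t` is the place of `t`. [folklore] -/
theorem pl_cmul (hθ : ∀ P Q : G, θ (P * Q) = θ P + θ Q) (hθc : θ c = (2, 0)) (t : G) : pl θ (c * t) = pl θ t := by
  simp only [pl, hθ, hθc, Prod.fst_add, Prod.snd_add, zero_add, map_add]
  rw [show QuarticTwist.par 2 = 0 by decide, zero_add]

omit [Fintype G] [Fintype B] [DecidableEq B] in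
/-- **Places of `G` are clock places**: `t' ∈ {t, ct} ↔ pl θ t' = pl θ t`. [folklore] -/
theorem mem_orb_iff_pl_eq (hθ : ∀ P Q : G, θ (P * Q) = θ P + θ Q) (hθc : θ c = (2, 0)) (t t' : G) :
    t' ∈ orb c t ↔ pl θ t' = pl θ t := by
  rw [mem_orb]
  constructor
  · rintro (rfl | rfl)
    · rfl
    · exact pl_cmul θ hθ hθc t
  · intro h
    simp only [pl, Prod.mk.injEq] at h
    obtain ⟨h1, h2⟩ := h
    rcases (par_eq_par_iff _ _).mp h1 with h3 | h3
    · left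
      exact θ.injective (Prod.ext h3 h2)
    · right
      apply θ.injective
      simp only [hθ, hθc, Prod.ext_iff, Prod.fst_add, Prod.snd_add, zero_add]
      exact ⟨h3, h2⟩

omit [Fintype G] [Fintype B] [DecidableEq B] in
/-- Distinct places: `t' ∉ {t, ct} ↔ pl θ t' ≠ pl θ t`. [folklore] -/
theorem not_mem_orb_iff_pl_ne (hθ : ∀ P Q : G, θ (P * Q) = θ P + θ Q) (hθc : θ c = (2, 0)) (t t' : G) :
    t' ∉ orb c t ↔ pl θ t' ≠ pl θ t := by
  rw [mem_orb_iff_pl_eq θ hθ hθc]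

/-- Clock arithmetic of a flip: removing the place `{a, a+2}` from the arc `{L, L+1}` and adding the other element gives the arc starting at
`L + step (par a) L`. [folklore] -/
private theorem arc_flip : ∀ x a L : ZMod 4,
    (((x = L ∨ x = L + 1) ∧ ¬ (x = a ∨ x = 2 + a)) ∨ ((x = a ∨ x = 2 + a) ∧ ¬ (x = L ∨ x = L + 1))) ↔
      (x = L + step (QuarticTwist.par a) L ∨ x = L + step (QuarticTwist.par a) L + 1) := by
  decide

omit [Fintype B] in
/-- **The abstract flip is the clock flip**: `lab (Ψ ∆ {t, ct}) = flip (pl θ t) (lab Ψ)`. [folklore] -/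
theorem lab_oflipCM (hθ : ∀ P Q : G, θ (P * Q) = θ P + θ Q) (hθc : θ c = (2, 0)) (hc2 : c * c = 1) (t : G) (Ψ : CMF G c) :
    lab θ (oflipCM c hc2 t Ψ) = flip B (pl θ t) (lab θ Ψ) := by
  funext b
  refine arc_unique _ _ fun x => ?_
  rw [← symm_mem_iff θ hθ hθc]
  show θ.symm (x, b) ∈ oflip c t Ψ.1 ↔ _
  rw [oflip, Finset.mem_symmDiff, mem_orb_iff_pl_eq θ hθ hθc, symm_mem_iff θ hθ hθc]
  simp only [pl, Equiv.apply_symm_apply]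
  by_cases hb : b = (θ t).2
  · rw [hb, flip_apply_self]
    simp only [Prod.mk.injEq, and_true, par_eq_par_iff]
    exact arc_flip x (θ t).1 (lab θ Ψ (θ t).2)
  · rw [flip_apply_of_ne B _ _ (by exact hb)]
    simp only [Prod.mk.injEq, hb, and_false, not_false_eq_true, and_true, false_and, or_false]

omit [Fintype B] in
/-- **Flips of types of labels**: `(typeOf s) ∆ {t, ct} = typeOf (flip (pl θ t) s)`. [folklore] -/
theorem oflipCM_typeOf (hθ : ∀ P Q : G, θ (P * Q) = θ P + θ Q) (hθc : θ c = (2, 0)) (hc2 : c * c = 1) (t : G) (s : Ty B) :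
    oflipCM c hc2 t (typeOf θ hθ hθc s) = typeOf θ hθ hθc (flip B (pl θ t) s) := by
  apply lab_injective θ hθ hθc
  rw [lab_oflipCM θ hθ hθc, lab_typeOf, lab_typeOf]

omit [Fintype B] in
/-- Flips at clock places: `(typeOf s) ∆ (place p) = typeOf (flip p s)` with the place represented by `plInv θ p`. [folklore] -/
theorem oflipCM_plInv_typeOf (hθ : ∀ P Q : G, θ (P * Q) = θ P + θ Q) (hθc : θ c = (2, 0)) (hc2 : c * c = 1) (p : ZMod 2 × B) (s : Ty B) :
    oflipCM c hc2 (plInv θ p) (typeOf θ hθ hθc s) = typeOf θ hθ hθc (flip B p s) := by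
  rw [oflipCM_typeOf θ hθ hθc, pl_plInv]

omit [Fintype G] [Fintype B] [DecidableEq B] in
/-- Distinct clock places are distinct places of `G`: `p ≠ q → plInv q ∉ {plInv p, c·plInv p}`. [folklore] -/
theorem plInv_not_mem_orb (hθ : ∀ P Q : G, θ (P * Q) = θ P + θ Q) (hθc : θ c = (2, 0)) {p q : ZMod 2 × B} (hpq : p ≠ q) :
    plInv θ q ∉ orb c (plInv θ p) := by
  rw [not_mem_orb_iff_pl_ne θ hθ hθc, pl_plInv, pl_plInv]
  exact Ne.symm hpq

end

end Summit.HodgeConjecture.CorCM.Census.ClockTypes
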